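import Mathlib.Tactic.Ring
import HarnessLib

/-!
# [OURS · L1 W4.5(b) · EL♮(3)] Specimen G₆ — «THE DOUBLE CUSPIDAL-CUBIC CONE», the 52nd registration's customer germ: chart identities of the word v1′
# (res-L1-w45b-lead-1 g22; idea-3 g17 bus l.38648/l.38652 (the walk, by hand), desk R86/R87 (word v1′ = q · p₁ · m · γ₁ → END; GATE (a) legs (α) = kit j332105 /
# j332106 / j332160 of this seat, (β′) crit-3 l.38755); crux `EquisingularLiftNatThree`, stmt-ResolutionOfSingularities-20148)

NOT a statement of any manuscript; OURS kernel specimen.  AI-written, weaker than expert review.  Nothing of [Hironaka2017] is asserted; EL♮(3) is NOT proved here;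
door membership / non-membership of G₆ is the panel's by-letters business (R86/R87), not this file's.  This file certifies the polynomial identities behind the
four charts of the word v1′; the kit (all charts, random instances over 𝔽_p) and the pens supply the rest (isolatedness of q, the 24 umbrellas, END).
THE OBJECT: `F = c₃² + f₈ + f₉` at `q` (`w = 1`), `c₃ = y²z − x³`, `f₈`, `f₉` ternary FORMS of degrees 8, 9 with `f₈(0,0,1) ≠ 0`.  Below `u`, `w`, `U` are ring
elements standing for `f₈(x,y,1)`, `f₉(x,y,1)` (chart z: `fₖ(xz, yz, z) = zᵏ·fₖ(x, y, 1)` by homogeneity) and for the unit `u + z·w` near `p₁`.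
* `qstep_chart_z`  : `(c₃² + f₈ + f₉)(xz, yz, z) = z⁶ · ((y² − x³)² + z²u + z³w)` — strict transform `G = (y² − x³)² + z²(u + zw)`, `Π_q = {z = 0}`, `Sing ∩ Π_q = γ₀ = V(z, y² − x³)`;
* `qstep_chart_x`  : the x-chart: `x⁶ · ((y²z − 1)² + x²u' + x³w')` (`γ₀ = V(x, y²z − 1)` there; the kit's `C1.0`);
* `G_near_p₁`      : `G = (y² − x³)² + z²·U` with `U := u + z·w` (idea-3 l.38652: a unit, so after `z̃ := z·√U` the germ at `p₁` is EXACTLY `(v² − t³)² + z̃²`);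
* `p1step_chart_t` : point step at `p₁` through `Π_q`, chart t (`v = v't, z = z't`): `(v'²t² − t³)² + (z't)²U = t² · (z'²U + t²(v'² − t)²)` — `Sing = m ∪ γ₁`, `m = {z' = t = 0}`,
                     `γ₁ = {z' = 0, t = v'²}` tangent to `m` at `p₂`;
* `mround_chart_t` : round along `m`, chart t (`z' = z''t`): `(z''t)²U + t²(v'² − t)² = t² · (z''²U + (v'² − t)²)` — in the coordinate `c := v'² − t` this is `U·z''² + c²`:
                     A₁ UNIFORMLY along `St γ₁ = {z'' = c = 0}`, no deep point over `p₂` (`gamma_form`);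
* `gammaround_chart`: round along `St γ₁` (`z'' = z'''·c`): `(z'''c)²U + c² = c² · (z'''²U + 1)` — the strict transform `z'''²U + 1` has no point on the new divisor: END.
`--supports stmt-ResolutionOfSingularities-20148 --as helper`; def-free; standard axioms.
-/

set_option linter.dupNamespace false -- mandated namespace `Summit.<Summit>.<Problem>` of this single-conjunct summit

namespace Summit.ResolutionOfSingularities.ResolutionOfSingularities.Cruxes.EquisingularLiftNat.Sections

namespace SpecimenG6CuspidalCubicCone

variable {R : Type} [CommRing R]

/-- [OURS · L1 W4.5b] Point step at `q`, chart z (`x ↦ xz, y ↦ yz`): `c₃(xz,yz,z)² + z⁸u + z⁹w = z⁶·((y² − x³)² + z²u + z³w)` (`u = f₈(x,y,1)`, `w = f₉(x,y,1)`). [folklore] -/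
theorem qstep_chart_z (x y z u w : R) :
    ((y * z) ^ 2 * z - (x * z) ^ 3) ^ 2 + z ^ 8 * u + z ^ 9 * w = z ^ 6 * ((y ^ 2 - x ^ 3) ^ 2 + z ^ 2 * u + z ^ 3 * w) := by
  ring

/-- [OURS · L1 W4.5b] Point step at `q`, chart x (`y ↦ yx, z ↦ zx`): `c₃(x,yx,zx)² + x⁸u' + x⁹w' = x⁶·((y²z − 1)² + x²u' + x³w')` (`u' = f₈(1,y,z)`, `w' = f₉(1,y,z)`);
on `Π_q = {x = 0}` the strict transform is `(y²z − 1)²`: `Sing(St H) ∩ Π_q ⊇ γ₀ = V(x, y²z − 1)` (the kit's `C1.0`). [folklore] -/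
theorem qstep_chart_x (x y z u' w' : R) :
    ((y * x) ^ 2 * (z * x) - x ^ 3) ^ 2 + x ^ 8 * u' + x ^ 9 * w' = x ^ 6 * ((y ^ 2 * z - 1) ^ 2 + x ^ 2 * u' + x ^ 3 * w') := by
  ring

/-- [OURS · L1 W4.5b] Near `p₁` (origin of chart z): `G = (y² − x³)² + z²·U` with `U = u + z·w` (a unit since `u(0,0) = f₈(0,0,1) ≠ 0`). [folklore] -/
theorem G_near_p₁ (x y z u w : R) :
    (y ^ 2 - x ^ 3) ^ 2 + z ^ 2 * u + z ^ 3 * w = (y ^ 2 - x ^ 3) ^ 2 + z ^ 2 * (u + z * w) := by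
  ring

/-- [OURS · L1 W4.5b] Point step at `p₁` THROUGH `Π_q`, chart t (`v ↦ vt, z ↦ zt`; here `t, v` = the chart-z coordinates `x, y`):
`(v²t² − t³)² + (zt)²U = t²·(z²U + t²(v² − t)²)` — strict transform `z²U + t²(v² − t)²`: singular along `m = {z = t = 0}` (A₁) and along
`γ₁ = {z = 0, t = v²} = St γ₀` (smooth: the cusp is resolved), the two TANGENT at `p₂` = origin. [folklore] -/
theorem p1step_chart_t (t v z U : R) :
    ((v * t) ^ 2 - t ^ 3) ^ 2 + (z * t) ^ 2 * U = t ^ 2 * (z ^ 2 * U + t ^ 2 * (v ^ 2 - t) ^ 2) := by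
  ring

/-- [OURS · L1 W4.5b] Round along `m = V(z, t)`, chart t (`z ↦ zt`): `(zt)²U + t²(v² − t)² = t²·(z²U + (v² − t)²)`. [folklore] -/
theorem mround_chart_t (t v z U : R) :
    (z * t) ^ 2 * U + t ^ 2 * (v ^ 2 - t) ^ 2 = t ^ 2 * (z ^ 2 * U + (v ^ 2 - t) ^ 2) := by
  ring

/-- [OURS · L1 W4.5b] After the `m`-round, in the coordinate `c := v² − t`: the strict transform is `U·z² + c²` — A₁ UNIFORMLY along `St γ₁ = {z = c = 0}` (`U` a unit),
NO deep point over `p₂`: the tangency of `γ₁` and `m` is gone (idea-3 l.38648 step (3); kit j332105 level 3: γ₁′ special points = the 24 umbrellas only). [folklore] -/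
theorem gamma_form (t v z U : R) :
    z ^ 2 * U + (v ^ 2 - t) ^ 2 = U * z ^ 2 + (v ^ 2 - t) ^ 2 := by
  ring

/-- [OURS · L1 W4.5b] Round along `St γ₁ = V(z, c)`, chart c (`z ↦ z·c`): `(zc)²U + c² = c²·(z²U + 1)` — the strict transform `z²U + 1` does not vanish where `z = 0`
or where `U·z²= −1` fails; over `St γ₁` it is a unit at `z = 0`: END of the word v1′ `q · p₁ · m · γ₁` (the other chart `c ↦ c·z` gives `z²(U + c'²)`, regular as `U` is a unit). [folklore] -/
theorem gammaround_chart (c z U : R) :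
    (z * c) ^ 2 * U + c ^ 2 = c ^ 2 * (z ^ 2 * U + 1) := by
  ring

/-- [OURS · L1 W4.5b] The other chart of the `γ₁`-round (`c ↦ c·z`): `z²U + (cz)² = z²·(U + c²)`. [folklore] -/
theorem gammaround_chart' (c z U : R) :
    z ^ 2 * U + (c * z) ^ 2 = z ^ 2 * (U + c ^ 2) := by
  ring

end SpecimenG6CuspidalCubicCone

end Summit.ResolutionOfSingularities.ResolutionOfSingularities.Cruxes.EquisingularLiftNat.Sections
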